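import Literature.Analysis.FluidPDE.DEIJShearStage
import Mathlib.Tactic.Linarith
import HarnessLib

/-!
# K1-Q1 via lamination trees: the 1-D laminate profile of the local node `LaminateStep` (Lemma P)

Cell `pub-nsfunc` (host summit NavierStokesRegularity, topic `FunctionalMining`), dictionary seat gen 9.
**Search for candidate a priori estimates; no regularity claim.** Pure one-dimensional calculus; nothing about
Navier–Stokes solutions (or about any field on `T³`) is asserted in this file.

This is **Lemma P of the dict blueprint `pub-nsfunc-dict/StretchingLaminateStep.BLUEPRINT.md` §1(b)**, the
first ingredient of the one remaining lower-side kernel node `LaminateStep` of K1-Q1 (staged file (ag)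
`StretchingLaminateStep.lean`): for a volume fraction `0 < λ < 1` and a ramp width `δ` (`0 < δ ≤ λ`,
`λ + δ < 1`) a smooth `1`-periodic profile whose DERIVATIVE takes EXACTLY the two plateau values `1 − λ`
(on `fract ∈ [δ, λ]`) and `−λ` (on `fract ∈ [λ + δ, 1) ∪ {0}`), lies in `[−λ, 1 − λ]` everywhere, and has zero
mean — so that along an integer direction `k` the laminate field `x ↦ Φ(k·x)·c` has gradient
`φ(k·x)·c ⊗ k` equal to the two child increments `(1−λ)c⊗k`, `−λ c⊗k` on slabs of measure `≥ λ − δ`,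
`≥ 1 − λ − δ` (the exactness of the PLATEAU VALUES is what lets the children's pointwise vorticity ceilings
apply verbatim; see the blueprint §2).

Construction (no ramp integral is ever computed): with Mathlib's `Real.smoothTransition =: ψ`,
`ramp λ δ (y) := ψ(fract y / δ) · (1 − ψ((fract y − λ)/δ))` — up-ramp on `[0, δ]`, plateau `1` on `[δ, λ]`,
the COMPLEMENTARY down-ramp `1 − ψ((· − λ)/δ)` on `[λ, λ+δ]`, `0` on `[λ+δ, 1]`; hence
`∫₀¹ ramp = (∫₀^δ ψ(u/δ) + λ − δ) + (1 − λ) − (∫₀^δ ψ(u/δ) + 1 − λ − δ) = λ` EXACTLY (the two ramps cancel),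
`φ := ramp − λ` has zero mean, and its primitive is `1`-periodic and smooth (pattern of the tree's
`DEIJ.sawS`). Main objects: `Laminate.ramp`, `Laminate.intervalIntegral_ramp` (`= λ`), `Laminate.stepPrim`
(a `ShearProfile`, mean zero) with `stepPrim_D_apply : (stepPrim …).D y = ramp λ δ y − λ` and the plateau /
range lemmas `stepPrimD_eq_of_plateauPlus/Minus`, `stepPrimD_mem_Icc`. [ours; elementary]
-/

noncomputable section

open MeasureTheory Set Filter Topology Function
open scoped ContDiff

namespace Summit.NavierStokesRegularity.FunctionalMining

open Literature.Analysis Literature.Analysis.FunctionSpaces Literature.Analysis.FunctionSpaces.Torus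
open Literature.Analysis.FluidPDE Literature.Analysis.FluidPDE.Torus

namespace Laminate

variable {lam δ : ℝ}

/-! ## 1. The ramp `b = ramp λ δ` and its smooth representatives -/

/-- **The laminate ramp** `b(y) = ψ(fract y/δ)·(1 − ψ((fract y − λ)/δ))`, `ψ = Real.smoothTransition`:
`0 → 1` on `[0, δ]`, `1` on `[δ, λ]`, `1 → 0` on `[λ, λ+δ]`, `0` on `[λ+δ, 1]`, `1`-periodic. [ours; elementary] -/
def ramp (lam δ y : ℝ) : ℝ :=
  Real.smoothTransition (Int.fract y / δ) * (1 - Real.smoothTransition ((Int.fract y - lam) / δ))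

/-- The smooth global representative of the ramp on the period `[n, n+1)`. [ours; bookkeeping] -/
def rampAux (lam δ : ℝ) (n : ℤ) (z : ℝ) : ℝ :=
  Real.smoothTransition ((z - n) / δ) * (1 - Real.smoothTransition ((z - n - lam) / δ))

/-- The ramp is `1`-periodic. [ours; elementary] -/
theorem ramp_periodic (lam δ : ℝ) : Function.Periodic (ramp lam δ) 1 := fun y => by
  simp [ramp, Int.fract_add_one]

/-- The representatives are smooth. [ours; elementary] -/
theorem contDiff_rampAux (lam δ : ℝ) (n : ℤ) : ContDiff ℝ ∞ (rampAux lam δ n) := by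
  have h1 : ContDiff ℝ ∞ fun z : ℝ => (z - n) / δ := (contDiff_id.sub contDiff_const).div_const _
  have h2 : ContDiff ℝ ∞ fun z : ℝ => (z - n - lam) / δ :=
    ((contDiff_id.sub contDiff_const).sub contDiff_const).div_const _
  unfold rampAux
  exact (Real.smoothTransition.contDiff.comp h1).mul
    (contDiff_const.sub (Real.smoothTransition.contDiff.comp h2))

/-- On the period containing `y` the ramp is its representative. [ours; bookkeeping] -/
theorem ramp_eq_aux {y z : ℝ} (hz : ⌊z⌋ = ⌊y⌋) : ramp lam δ z = rampAux lam δ ⌊y⌋ z := by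
  simp only [ramp, rampAux, Int.fract, hz]

/-- Near a non-integer the ramp coincides with a smooth global function. [ours; elementary] -/
theorem ramp_eventuallyEq_aux {y : ℝ} (hy : Int.fract y ≠ 0) :
    ramp lam δ =ᶠ[𝓝 y] rampAux lam δ ⌊y⌋ := by
  have h1 : (⌊y⌋ : ℝ) < y := by
    refine lt_of_le_of_ne (Int.floor_le y) fun h => hy ?_
    rw [Int.fract, h, sub_self]
  have h2 : y < ⌊y⌋ + 1 := Int.lt_floor_add_one y
  have hfl : ∀ᶠ z in 𝓝 y, ⌊z⌋ = ⌊y⌋ := by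
    filter_upwards [Ioo_mem_nhds h1 h2] with z hz
    exact Int.floor_eq_iff.2 ⟨hz.1.le, hz.2⟩
  exact hfl.mono fun z hz => ramp_eq_aux hz

/-- Near an integer `n` the ramp coincides with the representative of the period `[n, n+1)`: to the left of
`n` (inside `fract ∈ (λ+δ, 1)`) both vanish. [ours; elementary] -/
theorem ramp_eventuallyEq_aux_of_fract_eq_zero (hδ : 0 < δ) (hδl : δ ≤ lam) (h1 : lam + δ < 1) {y : ℝ}
    (hy : Int.fract y = 0) : ramp lam δ =ᶠ[𝓝 y] rampAux lam δ ⌊y⌋ := by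
  have hyn : y = ⌊y⌋ := by
    have h := hy; rw [Int.fract, sub_eq_zero] at h; exact h
  set n : ℤ := ⌊y⌋ with hn
  have hlo : (n : ℝ) - (1 - lam - δ) < y := by rw [hyn]; linarith
  have hhi : y < (n : ℝ) + 1 := by rw [hyn]; linarith
  filter_upwards [Ioo_mem_nhds hlo hhi] with z hz
  rcases le_or_gt (n : ℝ) z with hzn | hzn
  · -- same period
    have hfl : ⌊z⌋ = n := Int.floor_eq_iff.2 ⟨hzn, hz.2⟩
    have h := ramp_eq_aux (lam := lam) (δ := δ) (y := z) (z := z) rfl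
    rw [hfl] at h
    exact h
  · -- previous period: `fract z = z - n + 1 ∈ (λ + δ, 1)`, both sides vanish
    have hfl : ⌊z⌋ = n - 1 := Int.floor_eq_iff.2 ⟨by push_cast; linarith [hz.1], by push_cast; linarith⟩
    have hfr : Int.fract z = z - n + 1 := by rw [Int.fract, hfl]; push_cast; ring
    have ha : 1 ≤ (Int.fract z - lam) / δ := by
      rw [le_div_iff₀ hδ, hfr]; linarith [hz.1]
    have hb : (z - n) / δ ≤ 0 := div_nonpos_of_nonpos_of_nonneg (by linarith) hδ.le
    simp only [ramp, rampAux, Real.smoothTransition.one_of_one_le ha, Real.smoothTransition.zero_of_nonpos hb,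
      sub_self, mul_zero, zero_mul]

/-- **The ramp is smooth** (`0 < δ`, `λ + δ < 1`). [ours; elementary] -/
theorem contDiff_ramp (hδ : 0 < δ) (hδl : δ ≤ lam) (h1 : lam + δ < 1) : ContDiff ℝ ∞ (ramp lam δ) := by
  refine contDiff_iff_contDiffAt.2 fun y => ?_
  by_cases hy : Int.fract y = 0
  · exact (contDiff_rampAux lam δ ⌊y⌋).contDiffAt.congr_of_eventuallyEq
      (ramp_eventuallyEq_aux_of_fract_eq_zero hδ hδl h1 hy)
  · exact (contDiff_rampAux lam δ ⌊y⌋).contDiffAt.congr_of_eventuallyEq (ramp_eventuallyEq_aux hy)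

/-- The ramp is continuous. [ours; bookkeeping] -/
theorem continuous_ramp (hδ : 0 < δ) (hδl : δ ≤ lam) (h1 : lam + δ < 1) : Continuous (ramp lam δ) :=
  (contDiff_ramp hδ hδl h1).continuous

/-! ## 2. Values: range `[0,1]` and the two plateaus -/

/-- `0 ≤ b ≤ 1`. [ours; elementary] -/
theorem ramp_mem_Icc (lam δ y : ℝ) : ramp lam δ y ∈ Icc (0 : ℝ) 1 := by
  have ha0 := Real.smoothTransition.nonneg (Int.fract y / δ)
  have ha1 := Real.smoothTransition.le_one (Int.fract y / δ)
  have hb0 := Real.smoothTransition.nonneg ((Int.fract y - lam) / δ)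
  have hb1 := Real.smoothTransition.le_one ((Int.fract y - lam) / δ)
  constructor
  · exact mul_nonneg ha0 (by linarith)
  · calc ramp lam δ y ≤ 1 * 1 := mul_le_mul ha1 (by linarith) (by linarith) zero_le_one
      _ = 1 := one_mul 1

/-- **Upper plateau: `b = 1` where `δ ≤ fract y ≤ λ`.** [ours; elementary] -/
theorem ramp_eq_one (hδ : 0 < δ) {y : ℝ} (hy1 : δ ≤ Int.fract y) (hy2 : Int.fract y ≤ lam) :
    ramp lam δ y = 1 := by
  have ha : Real.smoothTransition (Int.fract y / δ) = 1 :=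
    Real.smoothTransition.one_of_one_le (by rw [le_div_iff₀ hδ]; linarith)
  have hb : Real.smoothTransition ((Int.fract y - lam) / δ) = 0 :=
    Real.smoothTransition.zero_of_nonpos (div_nonpos_of_nonpos_of_nonneg (by linarith) hδ.le)
  rw [ramp, ha, hb]; norm_num

/-- **Lower plateau: `b = 0` where `λ + δ ≤ fract y`.** [ours; elementary] -/
theorem ramp_eq_zero (hδ : 0 < δ) {y : ℝ} (hy : lam + δ ≤ Int.fract y) : ramp lam δ y = 0 := by
  have hb : Real.smoothTransition ((Int.fract y - lam) / δ) = 1 :=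
    Real.smoothTransition.one_of_one_le (by rw [le_div_iff₀ hδ]; linarith)
  rw [ramp, hb]; norm_num

/-- Lower plateau at the integers: `b = 0` where `fract y = 0`. [ours; elementary] -/
theorem ramp_eq_zero_of_fract_eq_zero {y : ℝ} (hy : Int.fract y = 0) : ramp lam δ y = 0 := by
  have ha : Real.smoothTransition (Int.fract y / δ) = 0 :=
    Real.smoothTransition.zero_of_nonpos (by rw [hy, zero_div])
  rw [ramp, ha, zero_mul]

/-! ## 3. The exact mean `∫₀¹ b = λ` (complementary ramps; no ramp integral is computed) -/

/-- `∫₀ᵃ ψ(u/δ) du = ∫₀^δ ψ(u/δ) du + (a − δ)` for `δ ≤ a` (`ψ = 1` on `[δ, a]`). [ours; elementary] -/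
theorem intervalIntegral_transition_eq (hδ : 0 < δ) {a : ℝ} (ha : δ ≤ a) :
    ∫ u in (0 : ℝ)..a, Real.smoothTransition (u / δ) =
      (∫ u in (0 : ℝ)..δ, Real.smoothTransition (u / δ)) + (a - δ) := by
  set g : ℝ → ℝ := fun u => Real.smoothTransition (u / δ) with hg
  have hgc : Continuous g := Real.smoothTransition.continuous.comp (continuous_id.div_const _)
  have hgi : ∀ s t : ℝ, IntervalIntegrable g volume s t := fun s t => hgc.intervalIntegrable s t
  rw [← intervalIntegral.integral_add_adjacent_intervals (hgi 0 δ) (hgi δ a)]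
  congr 1
  have h : ∫ u in δ..a, g u = ∫ u in δ..a, (1 : ℝ) := by
    refine intervalIntegral.integral_congr fun u hu => ?_
    rw [uIcc_of_le ha] at hu
    simp only [hg]
    exact Real.smoothTransition.one_of_one_le (by rw [le_div_iff₀ hδ]; linarith [hu.1])
  rw [h, intervalIntegral.integral_const, smul_eq_mul, mul_one]

/-- **`∫₀¹ ramp λ δ = λ` exactly** (`0 < δ ≤ λ`, `λ + δ ≤ 1`). [ours; elementary] -/
theorem intervalIntegral_ramp (hδ : 0 < δ) (hδl : δ ≤ lam) (h1 : lam + δ ≤ 1) :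
    ∫ y in (0 : ℝ)..1, ramp lam δ y = lam := by
  -- replace by the representative of the period `[0,1)` (they agree off `y = 1`)
  have hcongr : ∫ y in (0 : ℝ)..1, ramp lam δ y = ∫ y in (0 : ℝ)..1, rampAux lam δ 0 y := by
    refine intervalIntegral.integral_congr_ae ?_
    have : ∀ᵐ y : ℝ, y ≠ 1 := by simp [ae_iff, measure_singleton]
    filter_upwards [this] with y hy1 hy
    rw [uIoc_of_le zero_le_one] at hy
    have hfl : ⌊y⌋ = 0 := Int.floor_eq_iff.2 ⟨by exact_mod_cast hy.1.le, by
      push_cast; exact lt_of_le_of_ne (by linarith [hy.2]) (by simpa using hy1)⟩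
    have h := ramp_eq_aux (lam := lam) (δ := δ) (y := y) (z := y) rfl
    rw [hfl] at h
    exact h
  rw [hcongr]
  set g : ℝ → ℝ := fun u => Real.smoothTransition (u / δ) with hg
  have hgc : Continuous g := Real.smoothTransition.continuous.comp (continuous_id.div_const _)
  have hgi : ∀ s t : ℝ, IntervalIntegrable g volume s t := fun s t => hgc.intervalIntegrable s t
  have e : rampAux lam δ 0 = fun y => g y * (1 - g (y - lam)) := by
    funext y
    simp only [rampAux, hg, Int.cast_zero, sub_zero]
  rw [e]
  have hfc : Continuous fun y => g y * (1 - g (y - lam)) :=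
    hgc.mul (continuous_const.sub (hgc.comp (continuous_id.sub continuous_const)))
  have hfi : ∀ s t : ℝ, IntervalIntegrable (fun y => g y * (1 - g (y - lam))) volume s t :=
    fun s t => hfc.intervalIntegrable s t
  rw [← intervalIntegral.integral_add_adjacent_intervals (hfi 0 lam) (hfi lam 1)]
  -- on `[0, λ]` the down-ramp factor is `1`
  have hA : ∫ y in (0 : ℝ)..lam, g y * (1 - g (y - lam)) = ∫ y in (0 : ℝ)..lam, g y := by
    refine intervalIntegral.integral_congr fun y hy => ?_
    rw [uIcc_of_le (by linarith)] at hy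
    have hz : g (y - lam) = 0 := by
      simp only [hg]
      exact Real.smoothTransition.zero_of_nonpos (div_nonpos_of_nonpos_of_nonneg (by linarith [hy.2]) hδ.le)
    simp only [hz, sub_zero, mul_one]
  -- on `[λ, 1]` the up-ramp factor is `1`
  have hB : ∫ y in lam..(1 : ℝ), g y * (1 - g (y - lam)) = ∫ y in lam..(1 : ℝ), (1 - g (y - lam)) := by
    refine intervalIntegral.integral_congr fun y hy => ?_
    rw [uIcc_of_le (by linarith)] at hy
    have ho : g y = 1 := by
      simp only [hg]
      exact Real.smoothTransition.one_of_one_le (by rw [le_div_iff₀ hδ]; linarith [hy.1])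
    simp only [ho, one_mul]
  have hB' : ∫ y in lam..(1 : ℝ), (1 - g (y - lam)) = (1 - lam) - ∫ u in (0 : ℝ)..(1 - lam), g u := by
    have hgi' : IntervalIntegrable (fun y => g (y - lam)) volume lam 1 :=
      (hgc.comp (continuous_id.sub continuous_const)).intervalIntegrable lam 1
    rw [intervalIntegral.integral_sub intervalIntegrable_const hgi', intervalIntegral.integral_const, smul_eq_mul,
      mul_one, intervalIntegral.integral_comp_sub_right g lam]
    norm_num
  rw [hA, hB, hB', intervalIntegral_transition_eq hδ hδl,
    intervalIntegral_transition_eq hδ (by linarith : δ ≤ 1 - lam)]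
  ring

/-- The profile slope `φ = b − λ` has zero mean over a period. [ours; elementary] -/
theorem intervalIntegral_ramp_sub (hδ : 0 < δ) (hδl : δ ≤ lam) (h1 : lam + δ < 1) :
    ∫ y in (0 : ℝ)..1, (ramp lam δ y - lam) = 0 := by
  rw [intervalIntegral.integral_sub ((continuous_ramp hδ hδl h1).intervalIntegrable 0 1) intervalIntegrable_const,
    intervalIntegral_ramp hδ hδl h1.le, intervalIntegral.integral_const, smul_eq_mul]
  ring

/-! ## 4. The primitive `Φ₀(y) = ∫₀ʸ (b − λ)` and the mean-zero profile `stepPrim` -/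

/-- The primitive `Φ₀(y) = ∫₀ʸ (ramp − λ)`. [ours; bookkeeping] -/
def prim (lam δ y : ℝ) : ℝ := ∫ t in (0 : ℝ)..y, (ramp lam δ t - lam)

/-- `Φ₀' = b − λ`. [ours; elementary] -/
theorem hasDerivAt_prim (hδ : 0 < δ) (hδl : δ ≤ lam) (h1 : lam + δ < 1) (y : ℝ) :
    HasDerivAt (prim lam δ) (ramp lam δ y - lam) y :=
  (((continuous_ramp hδ hδl h1).sub continuous_const).integral_hasStrictDerivAt 0 y).hasDerivAt

/-- `deriv Φ₀ = b − λ`. [ours; bookkeeping] -/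
theorem deriv_prim (hδ : 0 < δ) (hδl : δ ≤ lam) (h1 : lam + δ < 1) :
    deriv (prim lam δ) = fun y => ramp lam δ y - lam :=
  funext fun y => (hasDerivAt_prim hδ hδl h1 y).deriv

/-- `Φ₀` is smooth. [ours; elementary] -/
theorem contDiff_prim (hδ : 0 < δ) (hδl : δ ≤ lam) (h1 : lam + δ < 1) : ContDiff ℝ ∞ (prim lam δ) := by
  rw [contDiff_infty_iff_deriv, deriv_prim hδ hδl h1]
  exact ⟨fun y => (hasDerivAt_prim hδ hδl h1 y).differentiableAt, (contDiff_ramp hδ hδl h1).sub contDiff_const⟩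

/-- `Φ₀` is `1`-periodic (`b − λ` has zero mean). [ours; elementary] -/
theorem prim_periodic (hδ : 0 < δ) (hδl : δ ≤ lam) (h1 : lam + δ < 1) : Function.Periodic (prim lam δ) 1 := by
  intro y
  have hc : Continuous fun t => ramp lam δ t - lam := (continuous_ramp hδ hδl h1).sub continuous_const
  have hi : ∀ a b : ℝ, IntervalIntegrable (fun t => ramp lam δ t - lam) volume a b := fun a b =>
    hc.intervalIntegrable a b
  have hp : Function.Periodic (fun t => ramp lam δ t - lam) 1 := fun t => by
    simp only [ramp_periodic lam δ t]
  unfold prim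
  rw [← intervalIntegral.integral_add_adjacent_intervals (hi 0 y) (hi y (y + 1)),
    hp.intervalIntegral_add_eq y 0, zero_add, intervalIntegral_ramp_sub hδ hδl h1, add_zero]

/-- **The laminate step profile `Φ = Φ₀ − ∫₀¹Φ₀`** (smooth, `1`-periodic, mean zero) as a `ShearProfile`.
[ours; elementary] -/
def stepPrim (hδ : 0 < δ) (hδl : δ ≤ lam) (h1 : lam + δ < 1) : ShearProfile where
  toFun := fun y => prim lam δ y - ∫ t in (0 : ℝ)..1, prim lam δ t
  periodic' := fun y => by simp only [prim_periodic hδ hδl h1 y]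
  contDiff' := (contDiff_prim hδ hδl h1).sub contDiff_const

/-- Values of the step profile. [ours; bookkeeping] -/
theorem stepPrim_apply (hδ : 0 < δ) (hδl : δ ≤ lam) (h1 : lam + δ < 1) (y : ℝ) :
    stepPrim hδ hδl h1 y = prim lam δ y - ∫ t in (0 : ℝ)..1, prim lam δ t := rfl

/-- **`Φ' = b − λ`**: the derivative profile of the step profile is the ramp minus `λ`. [ours; elementary] -/
theorem stepPrim_D_apply (hδ : 0 < δ) (hδl : δ ≤ lam) (h1 : lam + δ < 1) (y : ℝ) :
    (stepPrim hδ hδl h1).D y = ramp lam δ y - lam := by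
  rw [ShearProfile.D_apply]
  have h : HasDerivAt (stepPrim hδ hδl h1 : ℝ → ℝ) (ramp lam δ y - lam) y := by
    have := (hasDerivAt_prim hδ hδl h1 y).sub_const (∫ t in (0 : ℝ)..1, prim lam δ t)
    exact this
  exact h.deriv

/-- **The step profile has zero mean: `∫₀¹ Φ = 0`.** [ours; elementary] -/
theorem intervalIntegral_stepPrim (hδ : 0 < δ) (hδl : δ ≤ lam) (h1 : lam + δ < 1) :
    ∫ y in (0 : ℝ)..1, stepPrim hδ hδl h1 y = 0 := by
  have hc : Continuous (prim lam δ) := (contDiff_prim hδ hδl h1).continuous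
  simp only [stepPrim_apply]
  rw [intervalIntegral.integral_sub (hc.intervalIntegrable 0 1) intervalIntegrable_const,
    intervalIntegral.integral_const, smul_eq_mul]
  ring

/-- **Plateau `+`: `Φ' = 1 − λ` where `δ ≤ fract y ≤ λ`.** [ours; elementary] -/
theorem stepPrimD_eq_of_plateauPlus (hδ : 0 < δ) (hδl : δ ≤ lam) (h1 : lam + δ < 1) {y : ℝ}
    (hy1 : δ ≤ Int.fract y) (hy2 : Int.fract y ≤ lam) : (stepPrim hδ hδl h1).D y = 1 - lam := by
  rw [stepPrim_D_apply, ramp_eq_one hδ hy1 hy2]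

/-- **Plateau `−`: `Φ' = −λ` where `λ + δ ≤ fract y`.** [ours; elementary] -/
theorem stepPrimD_eq_of_plateauMinus (hδ : 0 < δ) (hδl : δ ≤ lam) (h1 : lam + δ < 1) {y : ℝ}
    (hy : lam + δ ≤ Int.fract y) : (stepPrim hδ hδl h1).D y = -lam := by
  rw [stepPrim_D_apply, ramp_eq_zero hδ hy]; ring

/-- Plateau `−` at the integers: `Φ' = −λ` where `fract y = 0`. [ours; elementary] -/
theorem stepPrimD_eq_of_fract_eq_zero (hδ : 0 < δ) (hδl : δ ≤ lam) (h1 : lam + δ < 1) {y : ℝ}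
    (hy : Int.fract y = 0) : (stepPrim hδ hδl h1).D y = -lam := by
  rw [stepPrim_D_apply, ramp_eq_zero_of_fract_eq_zero hy]; ring

/-- **Range: `−λ ≤ Φ' ≤ 1 − λ` everywhere** (so `G + Φ'(k·x) c⊗n` stays on the segment `[G₋, G₊]`).
[ours; elementary] -/
theorem stepPrimD_mem_Icc (hδ : 0 < δ) (hδl : δ ≤ lam) (h1 : lam + δ < 1) (y : ℝ) :
    (stepPrim hδ hδl h1).D y ∈ Icc (-lam) (1 - lam) := by
  rw [stepPrim_D_apply]
  have h := ramp_mem_Icc lam δ y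
  exact ⟨by linarith [h.1], by linarith [h.2]⟩

/-- `Φ' = θ − λ` with the barycentric weight `θ = ramp ∈ [0,1]`: `G + Φ' c⊗n = (1−θ)·G₋ + θ·G₊` pointwise.
[ours; bookkeeping] -/
theorem stepPrimD_eq_convex (hδ : 0 < δ) (hδl : δ ≤ lam) (h1 : lam + δ < 1) (y : ℝ) :
    (stepPrim hδ hδl h1).D y = (1 - ramp lam δ y) * (-lam) + ramp lam δ y * (1 - lam) := by
  rw [stepPrim_D_apply]; ring

/-- `|Φ'| ≤ 1` (for `0 ≤ λ ≤ 1`, automatic from `0 < δ ≤ λ`, `λ + δ < 1`). [ours; elementary] -/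
theorem abs_stepPrimD_le (hδ : 0 < δ) (hδl : δ ≤ lam) (h1 : lam + δ < 1) (y : ℝ) :
    |(stepPrim hδ hδl h1).D y| ≤ 1 := by
  have h := stepPrimD_mem_Icc hδ hδl h1 y
  rw [abs_le]
  exact ⟨by linarith [h.1], by linarith [h.2]⟩

/-- The derivative profile on the circle takes the value `1 − λ` on the image of the `+` plateau.
[ours; bookkeeping] -/
theorem stepPrimD_onCircle_coe_of_plateauPlus (hδ : 0 < δ) (hδl : δ ≤ lam) (h1 : lam + δ < 1) {t : ℝ}
    (ht1 : δ ≤ Int.fract t) (ht2 : Int.fract t ≤ lam) :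
    (stepPrim hδ hδl h1).D.onCircle (t : UnitAddCircle) = 1 - lam := by
  rw [ShearProfile.onCircle_coe, stepPrimD_eq_of_plateauPlus hδ hδl h1 ht1 ht2]

/-- The derivative profile on the circle takes the value `−λ` on the image of the `−` plateau.
[ours; bookkeeping] -/
theorem stepPrimD_onCircle_coe_of_plateauMinus (hδ : 0 < δ) (hδl : δ ≤ lam) (h1 : lam + δ < 1) {t : ℝ}
    (ht : lam + δ ≤ Int.fract t) :
    (stepPrim hδ hδl h1).D.onCircle (t : UnitAddCircle) = -lam := by
  rw [ShearProfile.onCircle_coe, stepPrimD_eq_of_plateauMinus hδ hδl h1 ht]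

/-- The derivative profile on the circle lies in `[−λ, 1 − λ]`. [ours; bookkeeping] -/
theorem stepPrimD_onCircle_mem_Icc (hδ : 0 < δ) (hδl : δ ≤ lam) (h1 : lam + δ < 1) (b : UnitAddCircle) :
    (stepPrim hδ hδl h1).D.onCircle b ∈ Icc (-lam) (1 - lam) := by
  induction b using QuotientAddGroup.induction_on with
  | H t => rw [ShearProfile.onCircle_coe]; exact stepPrimD_mem_Icc hδ hδl h1 t

/-- **Admissible widths exist**: for `0 < λ < 1` the width `δ := min λ (1 − λ) / 4` satisfies
`0 < δ ≤ λ` and `λ + δ < 1` (and `δ ≤ (1−λ)/4`). [ours; bookkeeping] -/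
theorem width_admissible {lam : ℝ} (h0 : 0 < lam) (h1 : lam < 1) :
    0 < min lam (1 - lam) / 4 ∧ min lam (1 - lam) / 4 ≤ lam ∧ lam + min lam (1 - lam) / 4 < 1 := by
  have hm0 : 0 < min lam (1 - lam) := lt_min h0 (by linarith)
  have hm1 : min lam (1 - lam) ≤ lam := min_le_left _ _
  have hm2 : min lam (1 - lam) ≤ 1 - lam := min_le_right _ _
  exact ⟨by linarith, by linarith, by linarith⟩

end Laminate

end Summit.NavierStokesRegularity.FunctionalMining

end
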